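import Summits.BirchSwinnertonDyer.BirchSwinnertonDyer.Theorems.EisensteinPrimesX2OrderClauseLayerZero
import Summits.BirchSwinnertonDyer.BirchSwinnertonDyer.Theorems.EisensteinPrimesMazurTwinFamilyTowerRouteT
import HarnessLib

/-!
# Route `EisensteinPrimes`, line `mudescent`, stub `stub_lambdaCount_offLocus` (crux 3): the ORDER CLAUSE
# «X ≥ 1» BY NAME — census-row form, no abstract set of places (helper; closes nothing)

Seat `bsd-eis-lam-a` g13 (ANALYTIC half of stub 4), item stmt-BirchSwinnertonDyer-19033. Sequel of
`EisensteinPrimesX2OrderClauseLayerZero` (p612712): there the Tamagawa places entered as an abstract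
`S : Finset (HeightOneSpectrum (𝓞 ℚ))` with `p ∣ c_v`. Here the set is CONSTRUCTED from the curve, as in
the LEAD's twin-family packaging (`EisensteinPrimesMazurTwinFamilyTowerRouteT`, p609840): the places over
`splitPrimesOutside W p p` (lam-a p589499), at which `c_ℓ = v_ℓ(Δ_min)` (split, tree
`localTamagawaNumber_eq_ordMinimalDiscriminant_of_hasSplitMultiplicativeReductionAt`) is divisible by `p`
under the census hypothesis **(Ram_split): `p ∣ v_ℓ(Δ)` at every split `ℓ ≠ p`** — i.e. the Kummer
support of `W` contains no split prime (the NON-SPLIT-type and composite-non-split classes of lam-a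
MEMO-11/12; for a curve with a rational `p`-point a split `ℓ` with `p ∤ v_ℓ(Δ)` is `≡ 1 (mod p)`, p597211).

* `X2.card_splitPrimesOutside_lt_analyticLambda_of_forall_dvd` — `W` globally minimal, squarefree
  conductor, `p ≠ 2` multiplicative, `p ∣ #E(ℚ)_tors`, `v_p(#E(ℚ)_tors) = 1`, (Ram_split), `μ_an = 0` and
  `λ_an = n` certified ⇒ **`#{split ℓ ∣ N, ℓ ≠ p} < λ_an`**;
* `X2.sum_sFactor_lt_analyticLambda_of_forall_dvd` — plus unit `s`-factors ⇒ **`Σ_{split ℓ ≠ p} s_ℓ < λ_an`**,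
  the ORDER CLAUSE `X ≥ 1` of THEOREM C^mix's Sig for such realisers, BY NAME from census data.

Named PUBLISHED facts (hypotheses): `hPT` (Poitou–Tate over `ℚ`), `h415`, `hWu`, `hpar`. THEOREMS ONLY;
nothing about any particular curve; closes no stub; 0 cells / labels move; BSD / MC proved for no curve.
References: [GreenbergLNM1716] §5 pp. 114–118, p. 137; [Wuthrich2014] Thm. 16; [SilvermanATAEC1994]
Cor. IV.9.2(d) (`c_ℓ = v_ℓ(Δ)` split); HOME/lam-a-g12/lam-a-MEMO-12.md §1, §8.
-/

-- `Summit.BirchSwinnertonDyer.BirchSwinnertonDyer.…`: the summit and its single sub-problem share a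
-- name (D-0017 layout), as in every `EisensteinPrimes*` Theorems file.
set_option linter.dupNamespace false
set_option autoImplicit false

noncomputable section

open scoped Classical MatrixGroups ModularForm

open PowerSeries CongruenceSubgroup WeierstrassCurve NumberField IsDedekindDomain
  Literature.NumberTheory.EllipticCurves
  Literature.NumberTheory.EllipticCurves.ModularForms
  Literature.NumberTheory.EllipticCurves.Rank1Residual
  Literature.NumberTheory.EllipticCurves.GreenbergVatsal2000
  Literature.NumberTheory.EllipticCurves.Wuthrich2014
  Literature.NumberTheory.EllipticCurves.Greenberg1999
  Literature.NumberTheory.GaloisCohomology Literature.NumberTheory.GaloisRepresentations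
  Summit.BirchSwinnertonDyer.Rank1Residual
  Summit.BirchSwinnertonDyer.Rank1Residual.X1.TamagawaSqueeze
  Summit.BirchSwinnertonDyer.BirchSwinnertonDyer.Theorems.EisensteinPrimesMazurTwinFamily
  Summit.BirchSwinnertonDyer.BirchSwinnertonDyer.Theorems.EisensteinPrimesX2OrderClauseLayerZero

namespace Summit.BirchSwinnertonDyer.BirchSwinnertonDyer.Theorems.EisensteinPrimesX2OrderClauseNonsplitType

variable {W : WeierstrassCurve ℚ} [W.IsElliptic] [W.IsGloballyMinimal] {p : ℕ} [hp : Fact p.Prime]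

/-- **The census rows over `splitPrimesOutside W p p`**: under (Ram_split) the places `v_ℓ` of `𝓞 ℚ`
over the split primes `ℓ ≠ p` form a set `S'` of Tamagawa places (`p ∉ v`, `p ∣ c_v(E)`) with
`#S' = #splitPrimesOutside W p p`. Plumbing verbatim from the LEAD's
`X2.mazurMainConjectureAt_etaleEnd_twinFamily_of_valueCongr_unit` (places `primesEquiv.symm`, split
transport, `c_v = v_ℓ(Δ_min)`). [cite: SilvermanATAEC1994, Cor. IV.9.2(d)] -/
theorem exists_tamagawaPlaces_of_forall_dvd
    (hram : ∀ ℓ ∈ splitPrimesOutside W p p, (p : ℤ) ∣ padicValRat ℓ W.Δ) :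
    ∃ S' : Finset (HeightOneSpectrum (𝓞 ℚ)), S'.card = (splitPrimesOutside W p p).card ∧
      (∀ v ∈ S', ((p : ℕ) : 𝓞 ℚ) ∉ v.asIdeal) ∧
      ∀ v ∈ S', p ∣ (W.baseChange (v.adicCompletion ℚ)).localTamagawaNumber
        (v.adicCompletionIntegers ℚ) := by
  have hpp : p.Prime := hp.out
  set S : Finset ℕ := splitPrimesOutside W p p with hSdef
  let plc : S → HeightOneSpectrum (𝓞 ℚ) := fun x ↦
    (Rat.HeightOneSpectrum.primesEquiv (R := 𝓞 ℚ)).symm ⟨x.1, prime_of_mem_splitPrimesOutside x.2⟩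
  have hplc_mem : ∀ x : S, ((x.1 : ℕ) : 𝓞 ℚ) ∈ (plc x).asIdeal := fun x ↦
    (natCast_mem_asIdeal_iff_eq_primesEquiv_symm (plc x) (prime_of_mem_splitPrimesOutside x.2)).mpr rfl
  have hplc_inj : Function.Injective plc := by
    intro x y h
    have h' : (⟨x.1, prime_of_mem_splitPrimesOutside x.2⟩ : Nat.Primes) =
        ⟨y.1, prime_of_mem_splitPrimesOutside y.2⟩ :=
      (Rat.HeightOneSpectrum.primesEquiv (R := 𝓞 ℚ)).symm.injective h
    exact Subtype.ext (congrArg (Subtype.val : Nat.Primes → ℕ) h')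
  refine ⟨S.attach.image plc, ?_, ?_, ?_⟩
  · rw [Finset.card_image_of_injective _ hplc_inj, Finset.card_attach]
  · intro v hv hpv
    obtain ⟨x, -, rfl⟩ := Finset.mem_image.mp hv
    have h1 := (natCast_mem_asIdeal_iff_eq_primesEquiv_symm (plc x) hpp).mp hpv
    have h2 : (⟨x.1, prime_of_mem_splitPrimesOutside x.2⟩ : Nat.Primes) = ⟨p, hpp⟩ :=
      (Rat.HeightOneSpectrum.primesEquiv (R := 𝓞 ℚ)).symm.injective h1
    exact (ne_and_ne_of_mem_splitPrimesOutside x.2).1 (congrArg Subtype.val h2)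
  · intro v hv
    obtain ⟨x, -, rfl⟩ := Finset.mem_image.mp hv
    have hℓ : (x.1 : ℕ).Prime := prime_of_mem_splitPrimesOutside x.2
    haveI : Fact (x.1 : ℕ).Prime := ⟨hℓ⟩
    obtain ⟨hℓN, hsplit⟩ := dvd_and_split_of_mem_splitPrimesOutside x.2
    obtain ⟨hℓ', hsplit'⟩ := hsplit
    have hs : W.HasSplitMultiplicativeReductionAt (plc x) :=
      X2.GreenbergVatsalStrictSelmerMultiplicative.hasSplitMultiplicativeReductionAt_of_mem W x.1 hsplit'
        (hplc_mem x)
    rw [localTamagawaNumber_eq_ordMinimalDiscriminant_of_hasSplitMultiplicativeReductionAt (plc x) W hs]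
    have hv' : ((Rat.HeightOneSpectrum.primesEquiv (plc x) : Nat.Primes) : ℕ) = x.1 :=
      Rat.HeightOneSpectrum.primesEquiv_eq_of_natCast_mem (plc x) hℓ (hplc_mem x)
    rw [LocalTorsionMult.ordMinimalDiscriminant_eq_padicValInt W (plc x) hv']
    have hd : (p : ℤ) ∣ padicValRat x.1 W.Δ := hram x.1 x.2
    rw [← cast_minimalDiscriminantInt W, padicValRat.of_int] at hd
    exact_mod_cast hd

/-- **`#{split ℓ ∣ N, ℓ ≠ p} < λ_an` BY NAME**: `W / ℚ` globally minimal with squarefree conductor,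
`p ≠ 2` multiplicative, `p ∣ #E(ℚ)_tors` with `v_p(#E(ℚ)_tors) = 1`, (Ram_split) `p ∣ v_ℓ(Δ)` at every
split `ℓ ≠ p`, and a certified pair `μ_an = 0`, `λ_an = n` ⇒ `#splitPrimesOutside W p p < n`
(`X2.card_splitPrimesOutside_lt_analyticLambda` on the census rows of `exists_tamagawaPlaces_of_forall_dvd`).
[cite: GreenbergLNM1716, §5 pp. 114–118, p. 137] [cite: Wuthrich2014, Thm. 16 (p. 397)] -/
theorem X2.card_splitPrimesOutside_lt_analyticLambda_of_forall_dvd (hodd : p ≠ 2)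
    (hPT : poitouTate_selmerStructure_duality ℚ)
    (h415 : prop415ii_noFiniteSubmodule_of_ordinary_or_multiplicative)
    (hWu : thm16_charIdeal_dvd_multiplicative_of_reducible)
    (hpar : nonempty_modularParametrizationData) (hsq : Squarefree (W.conductorNorm ℤ))
    (hmult : W.HasMultiplicativeReductionAtPrime p) (htors : p ∣ W.torsionOrder)
    (hfac : (W.torsionOrder).factorization p = 1)
    (hram : ∀ ℓ ∈ splitPrimesOutside W p p, (p : ℤ) ∣ padicValRat ℓ W.Δ)
    {n : ℕ} (hμ0 : X2.AnalyticMuLE W p 0) (hlam : X2.AnalyticLambdaEq W p n) :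
    (splitPrimesOutside W p p).card < n := by
  obtain ⟨S', hcard, hSp, hcv⟩ := exists_tamagawaPlaces_of_forall_dvd (W := W) (p := p) hram
  exact X2.card_splitPrimesOutside_lt_analyticLambda W p hodd hPT h415 hWu hpar hsq hmult htors hfac S' hSp
    hcv hcard.symm.le hμ0 hlam

/-- **THE ORDER CLAUSE «`X ≥ 1`» BY NAME** — `Σ_{split ℓ ≠ p} s_ℓ < λ_an` at a split Eisenstein étale end
with (Ram_split) and unit `s`-factors: same hypotheses plus `s_ℓ = 1` on `splitPrimesOutside W p p`. This
is the inequality THEOREM C^mix's Sig asks of a non-split partner realiser `R q` (MEMO-12 §1), obtained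
from `R q`'s own `μ/λ` certificate — no reading of `e^{ns}`.
[cite: GreenbergLNM1716, §5 pp. 114–118, p. 137] [cite: GreenbergVatsal2000, §2 Prop. (2.4) (p. 22)] -/
theorem X2.sum_sFactor_lt_analyticLambda_of_forall_dvd (hodd : p ≠ 2)
    (hPT : poitouTate_selmerStructure_duality ℚ)
    (h415 : prop415ii_noFiniteSubmodule_of_ordinary_or_multiplicative)
    (hWu : thm16_charIdeal_dvd_multiplicative_of_reducible)
    (hpar : nonempty_modularParametrizationData) (hsq : Squarefree (W.conductorNorm ℤ))
    (hmult : W.HasMultiplicativeReductionAtPrime p) (htors : p ∣ W.torsionOrder)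
    (hfac : (W.torsionOrder).factorization p = 1)
    (hram : ∀ ℓ ∈ splitPrimesOutside W p p, (p : ℤ) ∣ padicValRat ℓ W.Δ)
    (hs1 : ∀ ℓ ∈ splitPrimesOutside W p p, sFactor p ℓ = 1)
    {n : ℕ} (hμ0 : X2.AnalyticMuLE W p 0) (hlam : X2.AnalyticLambdaEq W p n) :
    ∑ ℓ ∈ splitPrimesOutside W p p, sFactor p ℓ < n := by
  rw [Finset.sum_congr rfl hs1, Finset.sum_const, smul_eq_mul, mul_one]
  exact X2.card_splitPrimesOutside_lt_analyticLambda_of_forall_dvd hodd hPT h415 hWu hpar hsq hmult htors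
    hfac hram hμ0 hlam

end Summit.BirchSwinnertonDyer.BirchSwinnertonDyer.Theorems.EisensteinPrimesX2OrderClauseNonsplitType

end
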